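import Summits.CriticalPhenomena.PercolationContinuityZ3.Theorems.PercNearOneGluingNoHeavyLowerTailKNGoodThreeRelaysKNMass
import HarnessLib

/-!
# `NoHeavyLowerTail` (stmt-CriticalPhenomena-4575) — THEOREM C (borrowing certificate): world bookkeeping

Support file (`--supports stmt-CriticalPhenomena-4575`, hull-port prover `prim-hp-2`, gen 25).  No new definitions, no named
facts, no sorries; standard axioms.  Set-theoretic identities for `KNGoodThreeKN.core_borrow` (file `…KNGoodThreeRelaysBorrow.lean`):
the single-relay worlds `W3 = ab|c|t`, `W4 = tb|a|c`, `W14 = ab|tc`, `W12 = ac|tb` of the four terminals `a, t, b, c` inside the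
separation events `D_K = {{a,t} ↮ c}`, `D_a = {a ↮ {t,c}}`, `D_t = {t ↮ {a,c}}`, and the two "slack inclusions" that let the hub
`{a,t}` borrow the worlds `W3`, `W4` (prim-hp-2 MEMO-gen25 §1).
[cite: KozmaNitzan2024, Thm. 2 (p. 8), §3.2 Definition (p. 12)] [cite: VandenbergHaggstromKahn2005, Thm. 1.1 (pp. 3–5)]
-/

noncomputable section

namespace Summit.CriticalPhenomena.PercolationContinuityZ3.Theorems

open MeasureTheory Set Literature.Probability.LatticeModels Literature.Probability.Percolation
open scoped Classical

namespace KNGoodThreeKN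

open KNGoodPocketBHK

variable {V : Type*} [Fintype V]

/-- `μ(a↔b, {a,t}↮c) = μ(W3) + μ(a↔t↔b-world ∩ D_K)`: the world `W3 = ab|c|t` plus `W5 = atb|c`. [cite: KozmaNitzan2024, Thm. 2 proof (p. 8)] -/
theorem real_ab_DK_split (w : Sym2 V → unitInterval) (a t c b : V) :
    (prodBernoulli w).real (openConn a b ∩ avoidSet ({a, t} : Set V) {c}) =
      (prodBernoulli w).real (openConn a b ∩ (openConn a t)ᶜ ∩ avoidSet ({a, t} : Set V) {c}) + (prodBernoulli w).real ((openConn a t ∩ (openConn a b ∪ openConn t b)) ∩ avoidSet ({a, t} : Set V) {c}) := by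
  classical
  have hmeas : ∀ A : Set (BondConfig V), MeasurableSet A := fun _ => MeasurableSet.of_discrete
  have e : (openConn a b ∩ avoidSet ({a, t} : Set V) {c} : Set (BondConfig V)) = (openConn a b ∩ (openConn a t)ᶜ ∩ avoidSet ({a, t} : Set V) {c}) ∪ ((openConn a t ∩ (openConn a b ∪ openConn t b)) ∩ avoidSet ({a, t} : Set V) {c}) := by
    ext ω
    simp only [Set.mem_inter_iff, Set.mem_union, Set.mem_compl_iff, openConn, Set.mem_setOf_eq, mem_avoidSet_two_one]
    constructor
    · rintro ⟨hab, hD⟩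
      by_cases hat : (openGraph ω).Reachable a t
      · exact Or.inr ⟨⟨hat, Or.inl hab⟩, hD⟩
      · exact Or.inl ⟨⟨hab, hat⟩, hD⟩
    · rintro (⟨⟨hab, -⟩, hD⟩ | ⟨⟨hat, hab | htb⟩, hD⟩)
      · exact ⟨hab, hD⟩
      · exact ⟨hab, hD⟩
      · exact ⟨hat.trans htb, hD⟩
  have d : Disjoint (openConn a b ∩ (openConn a t)ᶜ ∩ avoidSet ({a, t} : Set V) {c} : Set (BondConfig V)) ((openConn a t ∩ (openConn a b ∪ openConn t b)) ∩ avoidSet ({a, t} : Set V) {c}) := by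
    rw [Set.disjoint_left]
    intro ω h1 h2
    simp only [Set.mem_inter_iff, Set.mem_compl_iff, openConn, Set.mem_setOf_eq, mem_avoidSet_two_one] at h1 h2
    exact h1.1.2 h2.1.1
  rw [e, measureReal_union d (hmeas _)]

/-- `μ(t↔b, {a,t}↮c) = μ(W4) + μ(a↔t↔b-world ∩ D_K)`: the world `W4 = tb|a|c` plus `W5 = atb|c`. [cite: KozmaNitzan2024, Thm. 2 proof (p. 8)] -/
theorem real_tb_DK_split (w : Sym2 V → unitInterval) (a t c b : V) :
    (prodBernoulli w).real (openConn t b ∩ avoidSet ({a, t} : Set V) {c}) =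
      (prodBernoulli w).real (openConn t b ∩ (openConn a t)ᶜ ∩ avoidSet ({a, t} : Set V) {c}) + (prodBernoulli w).real ((openConn a t ∩ (openConn a b ∪ openConn t b)) ∩ avoidSet ({a, t} : Set V) {c}) := by
  classical
  have hmeas : ∀ A : Set (BondConfig V), MeasurableSet A := fun _ => MeasurableSet.of_discrete
  have e : (openConn t b ∩ avoidSet ({a, t} : Set V) {c} : Set (BondConfig V)) = (openConn t b ∩ (openConn a t)ᶜ ∩ avoidSet ({a, t} : Set V) {c}) ∪ ((openConn a t ∩ (openConn a b ∪ openConn t b)) ∩ avoidSet ({a, t} : Set V) {c}) := by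
    ext ω
    simp only [Set.mem_inter_iff, Set.mem_union, Set.mem_compl_iff, openConn, Set.mem_setOf_eq, mem_avoidSet_two_one]
    constructor
    · rintro ⟨htb, hD⟩
      by_cases hat : (openGraph ω).Reachable a t
      · exact Or.inr ⟨⟨hat, Or.inr htb⟩, hD⟩
      · exact Or.inl ⟨⟨htb, hat⟩, hD⟩
    · rintro (⟨⟨htb, -⟩, hD⟩ | ⟨⟨hat, hab | htb⟩, hD⟩)
      · exact ⟨htb, hD⟩
      · exact ⟨hat.symm.trans hab, hD⟩
      · exact ⟨htb, hD⟩
  have d : Disjoint (openConn t b ∩ (openConn a t)ᶜ ∩ avoidSet ({a, t} : Set V) {c} : Set (BondConfig V)) ((openConn a t ∩ (openConn a b ∪ openConn t b)) ∩ avoidSet ({a, t} : Set V) {c}) := by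
    rw [Set.disjoint_left]
    intro ω h1 h2
    simp only [Set.mem_inter_iff, Set.mem_compl_iff, openConn, Set.mem_setOf_eq, mem_avoidSet_two_one] at h1 h2
    exact h1.1.2 h2.1.1
  rw [e, measureReal_union d (hmeas _)]

/-- `μ(a↔b, a↮{t,c}) = μ(W3) + μ(W14)`: the worlds `ab|c|t` and `ab|tc`. [cite: KozmaNitzan2024, Thm. 2 proof (p. 8)] -/
theorem real_ab_Da_split (w : Sym2 V → unitInterval) (a t c b : V) :
    (prodBernoulli w).real (openConn a b ∩ avoidSet ({a} : Set V) {t, c}) =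
      (prodBernoulli w).real (openConn a b ∩ (openConn a t)ᶜ ∩ avoidSet ({a, t} : Set V) {c}) + (prodBernoulli w).real (openConn a b ∩ (openConn a t)ᶜ ∩ openConn t c) := by
  classical
  have hmeas : ∀ A : Set (BondConfig V), MeasurableSet A := fun _ => MeasurableSet.of_discrete
  have e : (openConn a b ∩ avoidSet ({a} : Set V) {t, c} : Set (BondConfig V)) = (openConn a b ∩ (openConn a t)ᶜ ∩ avoidSet ({a, t} : Set V) {c}) ∪ (openConn a b ∩ (openConn a t)ᶜ ∩ openConn t c) := by
    ext ω
    simp only [Set.mem_inter_iff, Set.mem_union, Set.mem_compl_iff, openConn, Set.mem_setOf_eq, mem_avoidSet_two_one,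
      mem_avoidSet_one_two]
    constructor
    · rintro ⟨hab, hat, hac⟩
      by_cases htc : (openGraph ω).Reachable t c
      · exact Or.inr ⟨⟨hab, hat⟩, htc⟩
      · exact Or.inl ⟨⟨hab, hat⟩, hac, htc⟩
    · rintro (⟨⟨hab, hat⟩, hac, htc⟩ | ⟨⟨hab, hat⟩, htc⟩)
      · exact ⟨hab, hat, hac⟩
      · exact ⟨hab, hat, fun hac => hat (hac.trans htc.symm)⟩
  have d : Disjoint (openConn a b ∩ (openConn a t)ᶜ ∩ avoidSet ({a, t} : Set V) {c} : Set (BondConfig V)) (openConn a b ∩ (openConn a t)ᶜ ∩ openConn t c) := by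
    rw [Set.disjoint_left]
    intro ω h1 h2
    simp only [Set.mem_inter_iff, Set.mem_compl_iff, openConn, Set.mem_setOf_eq, mem_avoidSet_two_one] at h1 h2
    exact h1.2.2 h2.2
  rw [e, measureReal_union d (hmeas _)]

/-- `μ(t↔b, t↮{a,c}) = μ(W4) + μ(W12)`: the worlds `tb|a|c` and `ac|tb`. [cite: KozmaNitzan2024, Thm. 2 proof (p. 8)] -/
theorem real_tb_Dt_split (w : Sym2 V → unitInterval) (a t c b : V) :
    (prodBernoulli w).real (openConn t b ∩ avoidSet ({t} : Set V) {a, c}) =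
      (prodBernoulli w).real (openConn t b ∩ (openConn a t)ᶜ ∩ avoidSet ({a, t} : Set V) {c}) + (prodBernoulli w).real (openConn t b ∩ (openConn a t)ᶜ ∩ openConn a c) := by
  classical
  have hmeas : ∀ A : Set (BondConfig V), MeasurableSet A := fun _ => MeasurableSet.of_discrete
  have e : (openConn t b ∩ avoidSet ({t} : Set V) {a, c} : Set (BondConfig V)) = (openConn t b ∩ (openConn a t)ᶜ ∩ avoidSet ({a, t} : Set V) {c}) ∪ (openConn t b ∩ (openConn a t)ᶜ ∩ openConn a c) := by
    ext ω
    simp only [Set.mem_inter_iff, Set.mem_union, Set.mem_compl_iff, openConn, Set.mem_setOf_eq, mem_avoidSet_two_one,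
      mem_avoidSet_one_two]
    constructor
    · rintro ⟨htb, hta, htc⟩
      by_cases hac : (openGraph ω).Reachable a c
      · exact Or.inr ⟨⟨htb, fun hat => hta hat.symm⟩, hac⟩
      · exact Or.inl ⟨⟨htb, fun hat => hta hat.symm⟩, hac, htc⟩
    · rintro (⟨⟨htb, hat⟩, hac, htc⟩ | ⟨⟨htb, hat⟩, hac⟩)
      · exact ⟨htb, fun hta => hat hta.symm, htc⟩
      · exact ⟨htb, fun hta => hat hta.symm, fun htc => hat (hac.trans htc.symm)⟩
  have d : Disjoint (openConn t b ∩ (openConn a t)ᶜ ∩ avoidSet ({a, t} : Set V) {c} : Set (BondConfig V)) (openConn t b ∩ (openConn a t)ᶜ ∩ openConn a c) := by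
    rw [Set.disjoint_left]
    intro ω h1 h2
    simp only [Set.mem_inter_iff, Set.mem_compl_iff, openConn, Set.mem_setOf_eq, mem_avoidSet_two_one] at h1 h2
    exact h1.2.1 h2.2
  rw [e, measureReal_union d (hmeas _)]

/-- `μ(t↔b, a↮{t,c}) = μ(W4) + μ(t↔c, t↔b, a↮{t,c})`: the worlds `tb|a|c` and `tbc|a`. [cite: KozmaNitzan2024, Thm. 2 proof (p. 8)] -/
theorem real_tb_Da_split (w : Sym2 V → unitInterval) (a t c b : V) :
    (prodBernoulli w).real (openConn t b ∩ avoidSet ({a} : Set V) {t, c}) =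
      (prodBernoulli w).real (openConn t b ∩ (openConn a t)ᶜ ∩ avoidSet ({a, t} : Set V) {c}) + (prodBernoulli w).real ((openConn t c ∩ openConn t b) ∩ avoidSet ({a} : Set V) {t, c}) := by
  classical
  have hmeas : ∀ A : Set (BondConfig V), MeasurableSet A := fun _ => MeasurableSet.of_discrete
  have e : (openConn t b ∩ avoidSet ({a} : Set V) {t, c} : Set (BondConfig V)) = (openConn t b ∩ (openConn a t)ᶜ ∩ avoidSet ({a, t} : Set V) {c}) ∪ ((openConn t c ∩ openConn t b) ∩ avoidSet ({a} : Set V) {t, c}) := by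
    ext ω
    simp only [Set.mem_inter_iff, Set.mem_union, Set.mem_compl_iff, openConn, Set.mem_setOf_eq, mem_avoidSet_two_one,
      mem_avoidSet_one_two]
    constructor
    · rintro ⟨htb, hat, hac⟩
      by_cases htc : (openGraph ω).Reachable t c
      · exact Or.inr ⟨⟨htc, htb⟩, hat, hac⟩
      · exact Or.inl ⟨⟨htb, hat⟩, hac, htc⟩
    · rintro (⟨⟨htb, hat⟩, hac, htc⟩ | ⟨⟨htc, htb⟩, hat, hac⟩)
      · exact ⟨htb, hat, hac⟩
      · exact ⟨htb, hat, hac⟩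
  have d : Disjoint (openConn t b ∩ (openConn a t)ᶜ ∩ avoidSet ({a, t} : Set V) {c} : Set (BondConfig V)) ((openConn t c ∩ openConn t b) ∩ avoidSet ({a} : Set V) {t, c}) := by
    rw [Set.disjoint_left]
    intro ω h1 h2
    simp only [Set.mem_inter_iff, Set.mem_compl_iff, openConn, Set.mem_setOf_eq, mem_avoidSet_two_one,
      mem_avoidSet_one_two] at h1 h2
    exact h1.2.2 h2.1.1
  rw [e, measureReal_union d (hmeas _)]

/-- `μ(a↔b, t↮{a,c}) = μ(W3) + μ(a↔c, a↔b, t↮{a,c})`: the worlds `ab|c|t` and `abc|t`. [cite: KozmaNitzan2024, Thm. 2 proof (p. 8)] -/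
theorem real_ab_Dt_split (w : Sym2 V → unitInterval) (a t c b : V) :
    (prodBernoulli w).real (openConn a b ∩ avoidSet ({t} : Set V) {a, c}) =
      (prodBernoulli w).real (openConn a b ∩ (openConn a t)ᶜ ∩ avoidSet ({a, t} : Set V) {c}) + (prodBernoulli w).real ((openConn a c ∩ openConn a b) ∩ avoidSet ({t} : Set V) {a, c}) := by
  classical
  have hmeas : ∀ A : Set (BondConfig V), MeasurableSet A := fun _ => MeasurableSet.of_discrete
  have e : (openConn a b ∩ avoidSet ({t} : Set V) {a, c} : Set (BondConfig V)) = (openConn a b ∩ (openConn a t)ᶜ ∩ avoidSet ({a, t} : Set V) {c}) ∪ ((openConn a c ∩ openConn a b) ∩ avoidSet ({t} : Set V) {a, c}) := by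
    ext ω
    simp only [Set.mem_inter_iff, Set.mem_union, Set.mem_compl_iff, openConn, Set.mem_setOf_eq, mem_avoidSet_two_one,
      mem_avoidSet_one_two]
    constructor
    · rintro ⟨hab, hta, htc⟩
      by_cases hac : (openGraph ω).Reachable a c
      · exact Or.inr ⟨⟨hac, hab⟩, hta, htc⟩
      · exact Or.inl ⟨⟨hab, fun hat => hta hat.symm⟩, hac, htc⟩
    · rintro (⟨⟨hab, hat⟩, hac, htc⟩ | ⟨⟨hac, hab⟩, hta, htc⟩)
      · exact ⟨hab, fun hta => hat hta.symm, htc⟩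
      · exact ⟨hab, hta, htc⟩
  have d : Disjoint (openConn a b ∩ (openConn a t)ᶜ ∩ avoidSet ({a, t} : Set V) {c} : Set (BondConfig V)) ((openConn a c ∩ openConn a b) ∩ avoidSet ({t} : Set V) {a, c}) := by
    rw [Set.disjoint_left]
    intro ω h1 h2
    simp only [Set.mem_inter_iff, Set.mem_compl_iff, openConn, Set.mem_setOf_eq, mem_avoidSet_two_one,
      mem_avoidSet_one_two] at h1 h2
    exact h1.2.1 h2.1.1
  rw [e, measureReal_union d (hmeas _)]

/-- **Slack inclusion (a-side).**  With `F = {o↔{a,t}}∪𝒬`, `F_a = {o↔a}∪𝒬_a`, `F_t = {o↔t}∪𝒬_t` (`𝒬 = 𝒬_a ∪ 𝒬_t`):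
`μ(a↔b; F; D_K) + μ(a↔c,a↔b; F_t; D_t) ≤ μ(a↔t,b∈C_{at}; F; D_K) + μ(a↔b; F_a; D_a) + μ(a↔b; F_t; D_t)`
(the difference is the `F_a`-mass of the world `ab|tc`). [cite: KozmaNitzan2024, Thm. 2 proof (p. 8)] -/
theorem real_slack_a (w : Sym2 V → unitInterval) (o b a t c : V) (Qa Qt : Set (Set V)) :
    (prodBernoulli w).real (openConn a b ∩ (pocketAugSet ({a, t} : Set V) o (Qa ∪ Qt) ∩ avoidSet ({a, t} : Set V) {c})) +
        (prodBernoulli w).real ((openConn a c ∩ openConn a b) ∩ (pocketAugSet ({t} : Set V) o Qt ∩ avoidSet ({t} : Set V) {a, c})) ≤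
      (prodBernoulli w).real ((openConn a t ∩ (openConn a b ∪ openConn t b)) ∩
          (pocketAugSet ({a, t} : Set V) o (Qa ∪ Qt) ∩ avoidSet ({a, t} : Set V) {c})) +
        (prodBernoulli w).real (openConn a b ∩ (pocketAugSet ({a} : Set V) o Qa ∩ avoidSet ({a} : Set V) {t, c})) +
        (prodBernoulli w).real (openConn a b ∩ (pocketAugSet ({t} : Set V) o Qt ∩ avoidSet ({t} : Set V) {a, c})) := by
  classical
  set μ := prodBernoulli w with hμ
  haveI : IsProbabilityMeasure μ := by rw [hμ]; infer_instance
  have hmeas : ∀ A : Set (BondConfig V), MeasurableSet A := fun _ => MeasurableSet.of_discrete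
  set DK : Set (BondConfig V) := avoidSet {a, t} {c} with hDK
  set Da : Set (BondConfig V) := avoidSet {a} {t, c} with hDa
  set Dt : Set (BondConfig V) := avoidSet {t} {a, c} with hDt
  set F : Set (BondConfig V) := pocketAugSet {a, t} o (Qa ∪ Qt) with hF
  set FA : Set (BondConfig V) := pocketAugSet {a} o Qa with hFA
  set FT : Set (BondConfig V) := pocketAugSet {t} o Qt with hFT
  set h5 : Set (BondConfig V) := openConn a t ∩ (openConn a b ∪ openConn t b) with hh5
  set hab : Set (BondConfig V) := openConn a b with hhab
  set g8 : Set (BondConfig V) := openConn a c ∩ openConn a b with hg8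
  have memDK : ∀ ω, ω ∈ DK ↔ ¬ (openGraph ω).Reachable a c ∧ ¬ (openGraph ω).Reachable t c := fun ω => by
    rw [hDK]; exact mem_avoidSet_two_one a t c ω
  have memDa : ∀ ω, ω ∈ Da ↔ ¬ (openGraph ω).Reachable a t ∧ ¬ (openGraph ω).Reachable a c := fun ω => by
    rw [hDa]; exact mem_avoidSet_one_two a t c ω
  have memDt : ∀ ω, ω ∈ Dt ↔ ¬ (openGraph ω).Reachable t a ∧ ¬ (openGraph ω).Reachable t c := fun ω => by
    rw [hDt]; exact mem_avoidSet_one_two t a c ω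
  have memF : ∀ ω, ω ∈ F ↔ ((openGraph ω).Reachable o a ∨ (openGraph ω).Reachable o t) ∨
      openCluster ω o ∈ Qa ∪ Qt := fun ω => by rw [hF]; exact mem_pocketAugSet_two a t o _ ω
  have memFA : ∀ ω, ω ∈ FA ↔ (openGraph ω).Reachable o a ∨ openCluster ω o ∈ Qa := fun ω => by
    rw [hFA]; exact mem_pocketAugSet_one a o Qa ω
  have memFT : ∀ ω, ω ∈ FT ↔ (openGraph ω).Reachable o t ∨ openCluster ω o ∈ Qt := fun ω => by
    rw [hFT]; exact mem_pocketAugSet_one t o Qt ω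
  have dL : Disjoint (hab ∩ (F ∩ DK)) (g8 ∩ (FT ∩ Dt)) := by
    rw [Set.disjoint_left]
    rintro ω ⟨-, -, hD⟩ ⟨⟨hac, -⟩, -⟩
    exact ((memDK ω).1 hD).1 hac
  have incl : hab ∩ (F ∩ DK) ∪ g8 ∩ (FT ∩ Dt) ⊆ h5 ∩ (F ∩ DK) ∪ hab ∩ (FA ∩ Da) ∪ hab ∩ (FT ∩ Dt) := by
    rintro ω (⟨hab', hF', hD⟩ | ⟨hg8', hFT', hDt'⟩)
    · have hab'' : (openGraph ω).Reachable a b := by rw [hhab] at hab'; exact hab'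
      obtain ⟨hac, htc⟩ := (memDK ω).1 hD
      by_cases hat : (openGraph ω).Reachable a t
      · refine Or.inl (Or.inl ⟨?_, hF', hD⟩)
        rw [hh5]; exact ⟨hat, Or.inl hab''⟩
      · rcases (memF ω).1 hF' with (hoa | hot) | (hq | hq)
        · exact Or.inl (Or.inr ⟨hab', (memFA ω).2 (Or.inl hoa), (memDa ω).2 ⟨hat, hac⟩⟩)
        · exact Or.inr ⟨hab', (memFT ω).2 (Or.inl hot), (memDt ω).2 ⟨fun h => hat h.symm, htc⟩⟩
        · exact Or.inl (Or.inr ⟨hab', (memFA ω).2 (Or.inr hq), (memDa ω).2 ⟨hat, hac⟩⟩)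
        · exact Or.inr ⟨hab', (memFT ω).2 (Or.inr hq), (memDt ω).2 ⟨fun h => hat h.symm, htc⟩⟩
    · refine Or.inr ⟨?_, hFT', hDt'⟩
      rw [hg8] at hg8'; rw [hhab]; exact hg8'.2
  calc μ.real (hab ∩ (F ∩ DK)) + μ.real (g8 ∩ (FT ∩ Dt))
      = μ.real (hab ∩ (F ∩ DK) ∪ g8 ∩ (FT ∩ Dt)) := (measureReal_union dL (hmeas _)).symm
    _ ≤ μ.real (h5 ∩ (F ∩ DK) ∪ hab ∩ (FA ∩ Da) ∪ hab ∩ (FT ∩ Dt)) := measureReal_mono incl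
    _ ≤ μ.real (h5 ∩ (F ∩ DK) ∪ hab ∩ (FA ∩ Da)) + μ.real (hab ∩ (FT ∩ Dt)) := measureReal_union_le _ _
    _ ≤ μ.real (h5 ∩ (F ∩ DK)) + μ.real (hab ∩ (FA ∩ Da)) + μ.real (hab ∩ (FT ∩ Dt)) := by
        linarith [measureReal_union_le (μ := μ) (h5 ∩ (F ∩ DK)) (hab ∩ (FA ∩ Da))]

/-- **Slack inclusion (t-side)**, the mirror image of `real_slack_a`:
`μ(t↔b; F; D_K) + μ(t↔c,t↔b; F_a; D_a) ≤ μ(a↔t,b∈C_{at}; F; D_K) + μ(t↔b; F_t; D_t) + μ(t↔b; F_a; D_a)`.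
[cite: KozmaNitzan2024, Thm. 2 proof (p. 8)] -/
theorem real_slack_t (w : Sym2 V → unitInterval) (o b a t c : V) (Qa Qt : Set (Set V)) :
    (prodBernoulli w).real (openConn t b ∩ (pocketAugSet ({a, t} : Set V) o (Qa ∪ Qt) ∩ avoidSet ({a, t} : Set V) {c})) +
        (prodBernoulli w).real ((openConn t c ∩ openConn t b) ∩ (pocketAugSet ({a} : Set V) o Qa ∩ avoidSet ({a} : Set V) {t, c})) ≤
      (prodBernoulli w).real ((openConn a t ∩ (openConn a b ∪ openConn t b)) ∩
          (pocketAugSet ({a, t} : Set V) o (Qa ∪ Qt) ∩ avoidSet ({a, t} : Set V) {c})) +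
        (prodBernoulli w).real (openConn t b ∩ (pocketAugSet ({t} : Set V) o Qt ∩ avoidSet ({t} : Set V) {a, c})) +
        (prodBernoulli w).real (openConn t b ∩ (pocketAugSet ({a} : Set V) o Qa ∩ avoidSet ({a} : Set V) {t, c})) := by
  classical
  set μ := prodBernoulli w with hμ
  haveI : IsProbabilityMeasure μ := by rw [hμ]; infer_instance
  have hmeas : ∀ A : Set (BondConfig V), MeasurableSet A := fun _ => MeasurableSet.of_discrete
  set DK : Set (BondConfig V) := avoidSet {a, t} {c} with hDK
  set Da : Set (BondConfig V) := avoidSet {a} {t, c} with hDa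
  set Dt : Set (BondConfig V) := avoidSet {t} {a, c} with hDt
  set F : Set (BondConfig V) := pocketAugSet {a, t} o (Qa ∪ Qt) with hF
  set FA : Set (BondConfig V) := pocketAugSet {a} o Qa with hFA
  set FT : Set (BondConfig V) := pocketAugSet {t} o Qt with hFT
  set h5 : Set (BondConfig V) := openConn a t ∩ (openConn a b ∪ openConn t b) with hh5
  set htb : Set (BondConfig V) := openConn t b with hhtb
  set g9 : Set (BondConfig V) := openConn t c ∩ openConn t b with hg9
  have memDK : ∀ ω, ω ∈ DK ↔ ¬ (openGraph ω).Reachable a c ∧ ¬ (openGraph ω).Reachable t c := fun ω => by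
    rw [hDK]; exact mem_avoidSet_two_one a t c ω
  have memDa : ∀ ω, ω ∈ Da ↔ ¬ (openGraph ω).Reachable a t ∧ ¬ (openGraph ω).Reachable a c := fun ω => by
    rw [hDa]; exact mem_avoidSet_one_two a t c ω
  have memDt : ∀ ω, ω ∈ Dt ↔ ¬ (openGraph ω).Reachable t a ∧ ¬ (openGraph ω).Reachable t c := fun ω => by
    rw [hDt]; exact mem_avoidSet_one_two t a c ω
  have memF : ∀ ω, ω ∈ F ↔ ((openGraph ω).Reachable o a ∨ (openGraph ω).Reachable o t) ∨
      openCluster ω o ∈ Qa ∪ Qt := fun ω => by rw [hF]; exact mem_pocketAugSet_two a t o _ ω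
  have memFA : ∀ ω, ω ∈ FA ↔ (openGraph ω).Reachable o a ∨ openCluster ω o ∈ Qa := fun ω => by
    rw [hFA]; exact mem_pocketAugSet_one a o Qa ω
  have memFT : ∀ ω, ω ∈ FT ↔ (openGraph ω).Reachable o t ∨ openCluster ω o ∈ Qt := fun ω => by
    rw [hFT]; exact mem_pocketAugSet_one t o Qt ω
  have dL : Disjoint (htb ∩ (F ∩ DK)) (g9 ∩ (FA ∩ Da)) := by
    rw [Set.disjoint_left]
    rintro ω ⟨-, -, hD⟩ ⟨⟨htc, -⟩, -⟩
    exact ((memDK ω).1 hD).2 htc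
  have incl : htb ∩ (F ∩ DK) ∪ g9 ∩ (FA ∩ Da) ⊆ h5 ∩ (F ∩ DK) ∪ htb ∩ (FT ∩ Dt) ∪ htb ∩ (FA ∩ Da) := by
    rintro ω (⟨htb', hF', hD⟩ | ⟨hg9', hFA', hDa'⟩)
    · have htb'' : (openGraph ω).Reachable t b := by rw [hhtb] at htb'; exact htb'
      obtain ⟨hac, htc⟩ := (memDK ω).1 hD
      by_cases hat : (openGraph ω).Reachable a t
      · refine Or.inl (Or.inl ⟨?_, hF', hD⟩)
        rw [hh5]; exact ⟨hat, Or.inr htb''⟩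
      · rcases (memF ω).1 hF' with (hoa | hot) | (hq | hq)
        · exact Or.inr ⟨htb', (memFA ω).2 (Or.inl hoa), (memDa ω).2 ⟨hat, hac⟩⟩
        · exact Or.inl (Or.inr ⟨htb', (memFT ω).2 (Or.inl hot), (memDt ω).2 ⟨fun h => hat h.symm, htc⟩⟩)
        · exact Or.inr ⟨htb', (memFA ω).2 (Or.inr hq), (memDa ω).2 ⟨hat, hac⟩⟩
        · exact Or.inl (Or.inr ⟨htb', (memFT ω).2 (Or.inr hq), (memDt ω).2 ⟨fun h => hat h.symm, htc⟩⟩)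
    · refine Or.inr ⟨?_, hFA', hDa'⟩
      rw [hg9] at hg9'; rw [hhtb]; exact hg9'.2
  calc μ.real (htb ∩ (F ∩ DK)) + μ.real (g9 ∩ (FA ∩ Da))
      = μ.real (htb ∩ (F ∩ DK) ∪ g9 ∩ (FA ∩ Da)) := (measureReal_union dL (hmeas _)).symm
    _ ≤ μ.real (h5 ∩ (F ∩ DK) ∪ htb ∩ (FT ∩ Dt) ∪ htb ∩ (FA ∩ Da)) := measureReal_mono incl
    _ ≤ μ.real (h5 ∩ (F ∩ DK) ∪ htb ∩ (FT ∩ Dt)) + μ.real (htb ∩ (FA ∩ Da)) := measureReal_union_le _ _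
    _ ≤ μ.real (h5 ∩ (F ∩ DK)) + μ.real (htb ∩ (FT ∩ Dt)) + μ.real (htb ∩ (FA ∩ Da)) := by
        linarith [measureReal_union_le (μ := μ) (h5 ∩ (F ∩ DK)) (htb ∩ (FT ∩ Dt))]

end KNGoodThreeKN

end Summit.CriticalPhenomena.PercolationContinuityZ3.Theorems
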